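import Summits.CriticalPhenomena.PercolationContinuityZ3.Theorems.Transplant.FKThreeApexRimStep
import Summits.CriticalPhenomena.PercolationContinuityZ3.Theorems.Transplant.FKThreeApexWordTri
import HarnessLib

/-!
# Double fans `K₂ ∨ P_{m+1}`: the transfer word and its RIGID evaluation (moving-boundary cluster count)

Support file (`--supports stmt-CriticalPhenomena-4575`), FK sub-lane `prim-bschramm-fk-3` (gen 20); builds on p205010 (kernel theorem, internal
audit signed; external expert review pending).  No named facts, no sorries; standard axioms.  Memo `bschramm/prim-bschramm-fk-3/DOUBLE-FAN.md` §8.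
Layer 1 of the measure-level bridge for double fans (apices `a, b`; rim vertices `c 0, …, c m`; pairs: the axis `ab`, the spokes `a c_j`,
`b c_j`, the rim edges `c_j c_{j+1}`).  The TRANSFER WORD (`zDF`, `transferDF`) reads the weight vector block by block with the letters of
`…ThreeApexAlgebra` and the rim step of `…ThreeApexRimStep`:
`Z_0 = edgeAC(w_{a c_0}) · edgeBC(w_{b c_0}) · edgeAB(w_{ab}) · δ_0`, `Z_{j+1} = edgeAC(w_{a c_{j+1}}) · edgeBC(w_{b c_{j+1}}) · E_{w_{c_j c_{j+1}}} Z_j`,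
`transferDF = val_q(Z_m)`.  This file: the word, its RIGID evaluation — at rigid weights the word is `q^{closed_j} · e_{π_j}` (`zDF_rigid`,
`transferDF_rigid`) where `π_j ∈ P3` is the partition of the moving boundary `{a, b, c_j}` and `closed_j` counts the rim clusters closed off so far
(`P3.rim`, `P3.rimQ`, `P3.dfStep`, `dfState`, `dfClosed`) — and the rigid configuration `dfConf`.  The moving-boundary cluster-count invariant and
the transfer formula at rigid weights are the next file (`…DoubleFanRigid`); affine interpolation and negative correlation follow.
[cite: Grimmett2006, §1.4 eq. (1.20) (p. 15); §1.2 eq. (1.1) (p. 4)] [folklore]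
-/

noncomputable section

namespace Summit.CriticalPhenomena.PercolationContinuityZ3.Theorems

namespace FK

namespace ThreeApex

open Literature.Probability.LatticeModels Literature.Probability.Percolation
open scoped Classical

/-! ### Rim bookkeeping on the partition lattice -/

namespace P3

/-- The boundary partition after a RIGID rim step: if the rim edge is open (`z = true`) the new rim vertex takes the block of the old one;
otherwise the old rim vertex leaves and the new one is a singleton. [folklore] -/
def rim (π : P3) (z : Bool) : P3 := if z then π else (if π.rAB then ab else bot)

/-- Whether a rigid rim step closes off a cluster (the old rim vertex was a singleton block and the rim edge is closed). [folklore] -/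
def rimQ (π : P3) (z : Bool) : Bool := !z && !π.rAC && !π.rBC

/-- One rigid block of a double fan: rim step `z`, then the spokes `b c` (`y`) and `a c` (`x`) of the new rim vertex. [folklore] -/
def dfStep (π : P3) (x y z : Bool) : P3 :=
  let π₁ := π.rim z
  let π₂ := if y then π₁.joinBC else π₁
  if x then π₂.joinAC else π₂

/-- Block count through one rigid block: `blocks' + [closed off] + dec = blocks + 1` (`dec` = the number of merges of `clusterCount_attach`
for the new rim vertex attached to `a` (if `x`), `b` (if `y`), old `c` (if `z`)). [folklore] -/
theorem blocks_dfStep (π : P3) (x y z : Bool) :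
    (π.dfStep x y z).blocks + (if π.rimQ z then 1 else 0) + π.dec x y z = π.blocks + 1 := by
  cases π <;> cases x <;> cases y <;> cases z <;> decide

/-- `a ~ b` after the block. [folklore] -/
theorem rAB_dfStep (π : P3) (x y z : Bool) : (π.dfStep x y z).rAB = (π.attach x y z).rAB := by
  cases π <;> cases x <;> cases y <;> cases z <;> decide

/-- `a ~ c_new` after the block: the new vertex reaches `a` through one of its rays. [folklore] -/
theorem rAC_dfStep (π : P3) (x y z : Bool) : (π.dfStep x y z).rAC = (x || (y && π.rAB) || (z && π.rAC)) := by
  cases π <;> cases x <;> cases y <;> cases z <;> decide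

/-- `b ~ c_new` after the block. [folklore] -/
theorem rBC_dfStep (π : P3) (x y z : Bool) : (π.dfStep x y z).rBC = ((x && π.rAB) || y || (z && π.rBC)) := by
  cases π <;> cases x <;> cases y <;> cases z <;> decide

end P3

/-! ### Rigid letters and rim steps on basis vectors -/

/-- `conv (edgeAC 1)` joins `a, c`; `conv (edgeAC 0)` is the identity (on scaled basis vectors). [folklore] -/
theorem conv_edgeAC_bR_basis (x : Bool) (s : ℝ) (π : P3) :
    conv (edgeAC (bR x)) (V5.smul s (basisVec π)) = V5.smul s (basisVec (if x then π.joinAC else π)) := by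
  cases π <;> cases x <;> (ext <;> simp [conv, edgeAC, bR, V5.smul, basisVec, P3.joinAC, V5.total])

/-- `conv (edgeBC 1)` joins `b, c`; `conv (edgeBC 0)` is the identity. [folklore] -/
theorem conv_edgeBC_bR_basis (y : Bool) (s : ℝ) (π : P3) :
    conv (edgeBC (bR y)) (V5.smul s (basisVec π)) = V5.smul s (basisVec (if y then π.joinBC else π)) := by
  cases π <;> cases y <;> (ext <;> simp [conv, edgeBC, bR, V5.smul, basisVec, P3.joinBC, V5.total])

/-- The rigid axis letter on `δ_0`. [folklore] -/
theorem conv_edgeAB_bR_delta0 (t : Bool) : conv (edgeAB (bR t)) delta0 = V5.smul 1 (basisVec (if t then P3.ab else P3.bot)) := by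
  cases t <;> (ext <;> simp [conv, edgeAB, bR, V5.smul, basisVec, delta0, V5.total])

/-- **The rigid rim step on a basis vector**: `E_z e_π = q^{[closed off]} · e_{π.rim z}`. [folklore] -/
theorem rimStep_bR_basis (q : ℝ) (z : Bool) (s : ℝ) (π : P3) :
    rimStep q (bR z) (V5.smul s (basisVec π)) = V5.smul (s * (if π.rimQ z then q else 1)) (basisVec (π.rim z)) := by
  cases π <;> cases z <;> (ext <;> simp [rimStep, bR, V5.smul, basisVec, P3.rim, P3.rimQ, P3.rAB, P3.rAC, P3.rBC, mul_comm])

/-- One rigid block on a scaled basis vector. [folklore] -/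
theorem block_bR_basis (q : ℝ) (x y z : Bool) (s : ℝ) (π : P3) :
    conv (edgeAC (bR x)) (conv (edgeBC (bR y)) (rimStep q (bR z) (V5.smul s (basisVec π)))) =
      V5.smul (s * (if π.rimQ z then q else 1)) (basisVec (π.dfStep x y z)) := by
  rw [rimStep_bR_basis, conv_edgeBC_bR_basis, conv_edgeAC_bR_basis]
  rfl

/-! ### The transfer word of a double fan -/

variable {V : Type*} [Fintype V]

/-- The spoke and rim weights read off `w`, as reals. [folklore] -/
def wR (w : Sym2 V → unitInterval) (e : Sym2 V) : ℝ := ((w e : unitInterval) : ℝ)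

/-- **The transfer word** of the double fan with apices `a, b` and rim `c 0, …, c j`: block `0` is `edgeAC · edgeBC · edgeAB · δ_0`, block `j+1`
applies the rim step of the edge `c_j c_{j+1}` and then the spokes of `c_{j+1}`. [folklore] -/
def zDF (q : ℝ) (w : Sym2 V → unitInterval) (a b : V) (c : ℕ → V) : ℕ → V5
  | 0 => conv (edgeAC (wR w s(a, c 0))) (conv (edgeBC (wR w s(b, c 0))) (conv (edgeAB (wR w s(a, b))) delta0))
  | j + 1 => conv (edgeAC (wR w s(a, c (j + 1)))) (conv (edgeBC (wR w s(b, c (j + 1))))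
      (rimStep q (wR w s(c j, c (j + 1))) (zDF q w a b c j)))

/-- The transfer expression: `val_q` of the word after the last rim vertex `c m`. [folklore] -/
def transferDF (q : ℝ) (w : Sym2 V → unitInterval) (a b : V) (c : ℕ → V) (m : ℕ) : ℝ := val q (zDF q w a b c m)

/-- The pairs of the double fan: axis, spokes of `c 0 … c m`, rim edges `c_j c_{j+1}` (`j < m`). [folklore] -/
def dfPairs (a b : V) (c : ℕ → V) (m : ℕ) : Finset (Sym2 V) :=
  insert s(a, b) (((Finset.range (m + 1)).biUnion fun j => {s(a, c j), s(b, c j)}) ∪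
    ((Finset.range m).biUnion fun j => {s(c j, c (j + 1))}))

omit [Fintype V] in
/-- Membership in `dfPairs`. [folklore] -/
theorem mem_dfPairs_iff (a b : V) (c : ℕ → V) (m : ℕ) (e : Sym2 V) :
    e ∈ dfPairs a b c m ↔ e = s(a, b) ∨ (∃ j, j ≤ m ∧ (e = s(a, c j) ∨ e = s(b, c j))) ∨ (∃ j, j < m ∧ e = s(c j, c (j + 1))) := by
  simp only [dfPairs, Finset.mem_insert, Finset.mem_union, Finset.mem_biUnion, Finset.mem_range, Finset.mem_singleton, Nat.lt_succ_iff]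

/-! ### Rigid data and the rigid word -/

/-- Rigid Boolean data of a double fan: axis `t`, spokes `x j` (`a c_j`), `y j` (`b c_j`), rim edges `z j` (`c_j c_{j+1}`). [folklore] -/
structure DFData where
  /-- the axis `ab` is open -/
  t : Bool
  /-- the spoke `a c_j` is open -/
  x : ℕ → Bool
  /-- the spoke `b c_j` is open -/
  y : ℕ → Bool
  /-- the rim edge `c_j c_{j+1}` is open -/
  z : ℕ → Bool

/-- The boundary partition of `{a, b, c_j}` after block `j` of the rigid double fan. [folklore] -/
def dfState (d : DFData) : ℕ → P3
  | 0 => (if d.t then P3.top else P3.bc).dfStep (d.x 0) (d.y 0) false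
  | j + 1 => (dfState d j).dfStep (d.x (j + 1)) (d.y (j + 1)) (d.z j)

/-- The number of clusters closed off during the first `j` rim steps. [folklore] -/
def dfClosed (d : DFData) : ℕ → ℕ
  | 0 => 0
  | j + 1 => dfClosed d j + (if (dfState d j).rimQ (d.z j) then 1 else 0)

/-- The virtual start: `(a, b, b)` as boundary, so that block `0` is an ordinary block with a closed rim edge. [folklore] -/
theorem dfStep_start (t x y : Bool) :
    (if t then P3.top else P3.bc).dfStep x y false =
      (if x then (if y then (if t then P3.ab else P3.bot).joinBC else (if t then P3.ab else P3.bot)).joinAC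
        else (if y then (if t then P3.ab else P3.bot).joinBC else (if t then P3.ab else P3.bot))) := by
  cases t <;> cases x <;> cases y <;> decide

omit [Fintype V] in
/-- **The rigid word**: if every weight on the double fan is `0` or `1` (Boolean data `d`), then
`Z_j = q^{closed_j} · e_{π_j}`. [folklore] -/
theorem zDF_rigid (q : ℝ) (w : Sym2 V → unitInterval) (a b : V) (c : ℕ → V) (d : DFData)
    (ht : wR w s(a, b) = bR d.t) (hx : ∀ j, wR w s(a, c j) = bR (d.x j)) (hy : ∀ j, wR w s(b, c j) = bR (d.y j))
    (hz : ∀ j, wR w s(c j, c (j + 1)) = bR (d.z j)) :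
    ∀ j, zDF q w a b c j = V5.smul (q ^ dfClosed d j) (basisVec (dfState d j)) := by
  intro j
  induction j with
  | zero =>
    simp only [zDF, ht, hx, hy, conv_edgeAB_bR_delta0, conv_edgeBC_bR_basis, conv_edgeAC_bR_basis, dfClosed, pow_zero, dfState,
      dfStep_start]
  | succ j ih =>
    simp only [zDF, hx, hy, hz, ih, block_bR_basis, dfClosed, dfState]
    congr 1
    split_ifs <;> simp [pow_succ]

omit [Fintype V] in
/-- The rigid transfer value: `q^{closed_m + blocks(π_m)}`. [folklore] -/
theorem transferDF_rigid (q : ℝ) (w : Sym2 V → unitInterval) (a b : V) (c : ℕ → V) (d : DFData) (m : ℕ)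
    (ht : wR w s(a, b) = bR d.t) (hx : ∀ j, wR w s(a, c j) = bR (d.x j)) (hy : ∀ j, wR w s(b, c j) = bR (d.y j))
    (hz : ∀ j, wR w s(c j, c (j + 1)) = bR (d.z j)) :
    transferDF q w a b c m = q ^ (dfClosed d m + (dfState d m).blocks) := by
  rw [transferDF, zDF_rigid q w a b c d ht hx hy hz m, val_smul_basisVec, pow_add]

/-! ### The rigid configuration and the moving-boundary invariant -/

/-- The rigid configuration after block `j`: the axis (if open) and the stars of `c 0, …, c j` (each attached to `a`, `b`, and the previous
rim vertex according to the data; `c 0`'s "previous rim vertex" slot is unused). [folklore] -/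
def dfConf (a b : V) (c : ℕ → V) (d : DFData) : ℕ → Finset (Sym2 V)
  | 0 => (if d.t then {s(a, b)} else ∅) ∪ star (c 0) (attFin a b b (d.x 0) (d.y 0) false)
  | j + 1 => dfConf a b c d j ∪ star (c (j + 1)) (attFin a b (c j) (d.x (j + 1)) (d.y (j + 1)) (d.z j))

end ThreeApex

end FK

end Summit.CriticalPhenomena.PercolationContinuityZ3.Theorems
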